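import Literature.IUT.LogVolume.Corollary22OfThm110With
import Literature.NumberTheory.DiophantineGeometry.GenEllThm21WithLimit
import HarnessLib

/-!
# [IUTchIV] §2 with an exponent, in the LIMIT `Λ → 1⁺`: right-continuity of the dilated display in the
# coefficient; the interface for every `Λ > 1` is the record interface; print's transfer applies as is

Mochizuki, *Inter-universal Teichmüller theory IV*, RIMS manuscript (Apr. 2020; = PRIMS **57** (2021)),
Thm. 1.10 (first display as applied on p. 46 l. 1), Cor. 2.2 (pp. 41–48), Cor. 2.3 (pp. 54–55); Mochizuki,
*Arithmetic elliptic curves in general position* [GenEll] Thm. 2.1 (pp. 11–13). PROOF-ONLY file (no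
definitions); it only COMPOSES landed theorems. The [IUTchIV]-side twin of `GenEllThm21WithLimit.lean`
([GenEll] side: `abcCompactlyBounded_iff_forall_gt_one`, `abc_of_forall_gt_one_abcCompactlyBoundedWith`,
`abcWithExponent_one_of_forall_mu_abcCompactlyBoundedWith`).

WHAT IS PROVED (elementary bookkeeping; `Λ` multiplies the WHOLE right-hand side of the display,
`Cor22.DisplayWith`):

* §1 RIGHT-CONTINUITY IN THE COEFFICIENT. The dilated display at a point is a closed condition in `Λ`
  with a right-hand side `≥ 0` (`display_rhs_nonneg`), hence `DisplayWith P l η Λ₀ ↔ ∀ Λ > Λ₀,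
  DisplayWith P l η Λ` (`displayWith_iff_forall_gt`); the dilated Theorem-1.10 interface is a conjunction of
  pointwise displays under `Λ`-free hypotheses, hence `Thm110LegendreWith Λ₀ ↔ ∀ Λ > Λ₀, Thm110LegendreWith Λ`
  and in particular `Thm110Legendre ↔ ∀ Λ > 1, Thm110LegendreWith Λ` (`thm110Legendre_iff_forall_gt_one`); in
  the dilation currency `μ₀ = 1/Λ` of the conditional lines: `Thm110Legendre ↔ ∀ μ₀ ∈ (0,1),
  Thm110LegendreWith (1/μ₀)` (`thm110Legendre_iff_forall_mu`).
* §2 THE ENDS IN THE LIMIT. Consequently `(∀ Λ > 1, Thm110LegendreWith Λ)` — equivalently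
  `(∀ μ₀ ∈ (0,1), Thm110LegendreWith (1/μ₀))` — implies EVERYTHING the record interface implies, by the record
  chain BY NAME: Cor. 2.2 (`exists_corollary22_of_forall_gt_one_thm110LegendreWith`), [GenEll] Thm. 2.1 (ii) at
  `Σ = {2}` (`abcCompactlyBounded_two_of_forall_gt_one_thm110LegendreWith`), Cor. 2.3 for `ℙ¹` in every degree
  (`vojtaP1Deg_of_forall_gt_one_thm110LegendreWith`) and the displayed abc sentence
  (`abc_of_forall_gt_one_thm110LegendreWith`, `abc_of_forall_mu_thm110LegendreWith`) — with NO hypothesis of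
  the shape `GenEll_thm21_primesWith Λ`: print's (ii) ⇒ (i) transfer is used at `Λ = 1` only, where it is
  PROVED (`GenEll_thm21_primes_holds`). Each end is cross-checked in the kernel (`example`s) against the
  second route "(ii)_Λ at every `Λ > 1` (`abcCompactlyBoundedWith_two_of_thm110LegendreWith`) + the [GenEll]-side
  limit file".
* CONTRAST (R19, nothing new): at each FIXED `Λ > 1` the all-triples end `abcExp_of_thm110LegendreWith` needs
  the explicit open binder `GenEll_thm21_primesWith Λ`; only the cusp-avoiding families are transfer-free
  (`abcExpOn_farFromCusps_of_thm110LegendreWith`). In the limit `Λ → 1⁺` the binder disappears.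

WHAT IS NOT CLAIMED. Right-continuity in `Λ` of `PartIIWith D H Λ` or of `Corollary22With Λ H` is NOT
asserted and not provable by this bookkeeping: their constants `C_K, H_K`, exceptional sets `Exc_d` and primes
`l` are EXISTENTIALLY chosen for each `Λ` and may degenerate as `Λ → 1⁺` (e.g. `C_K(Λ) → ∞`). The limit is
taken at the level of the pointwise display / the interface `Thm110LegendreWith`, which is exactly the level
at which the tree's conditional lines deliver (`displayWith_one_div_of_dilated`). Nothing here asserts that
any display holds at any datum, that `Thm110LegendreWith Λ` holds for any `Λ`, or that abc (with any
exponent) is proved or refuted; no side is taken on [IUTchIII] Cor. 3.12 / [IUTchIV] Thm. 1.10 or on any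
author; typed ≠ proved.
-/

noncomputable section

namespace Literature.IUT.LogVolume

namespace Cor22

open Literature.NumberTheory.DiophantineGeometry.GenEll Literature.NumberTheory.DiophantineGeometry

/-- `{2}` is a set of primes. [folklore] -/
private theorem two_primes : ∀ p ∈ ({2} : Finset ℕ), p.Prime := fun p hp => by
  rw [Finset.mem_singleton] at hp; subst hp; exact Nat.prime_two

/-- **Right-continuity of `a ≤ Λ·b` in `Λ` for `b ≥ 0`**: if `a ≤ Λ·b` for every `Λ > Λ₀`, then
`a ≤ Λ₀·b` (for `ε > 0` take `Λ := Λ₀ + ε/(b+1)`, so that `Λ·b < Λ₀·b + ε`). [folklore] -/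
private theorem le_mul_of_forall_gt_le_mul {a b Λ₀ : ℝ} (hb : 0 ≤ b)
    (h : ∀ Λ : ℝ, Λ₀ < Λ → a ≤ Λ * b) : a ≤ Λ₀ * b := by
  refine le_of_forall_pos_lt_add fun ε hε => ?_
  have hb1 : 0 < b + 1 := by linarith
  have hΛ : Λ₀ < Λ₀ + ε / (b + 1) := lt_add_of_pos_right _ (div_pos hε hb1)
  have hlt : ε / (b + 1) * b < ε := by
    rw [div_mul_eq_mul_div, div_lt_iff₀ hb1]
    linarith
  calc a ≤ (Λ₀ + ε / (b + 1)) * b := h _ hΛ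
    _ = Λ₀ * b + ε / (b + 1) * b := by ring
    _ < Λ₀ * b + ε := by linarith

/-! ## §1 Right-continuity of the dilated display and of the dilated interface in the coefficient -/

/-- **The dilated display is RIGHT-CONTINUOUS in the coefficient** (`η ≥ 0`, any `Λ₀`):
`DisplayWith P l η Λ₀ ↔ ∀ Λ > Λ₀, DisplayWith P l η Λ`.  (⇒) monotonicity (`DisplayWith.mono`);
(⇐) the right-hand side of the display is `≥ 0` (`display_rhs_nonneg`), so `LHS ≤ Λ·RHS` for every `Λ > Λ₀`
forces `LHS ≤ Λ₀·RHS`. [claim: Mochizuki2012, status: disputed] -/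
theorem displayWith_iff_forall_gt {P : NFPoint} {l : ℕ} {η : ℝ} (hη : 0 ≤ η) (Λ₀ : ℝ) :
    DisplayWith P l η Λ₀ ↔ ∀ Λ : ℝ, Λ₀ < Λ → DisplayWith P l η Λ := by
  refine ⟨fun h Λ hΛ => h.mono hη hΛ.le, fun h => ?_⟩
  unfold DisplayWith at h ⊢
  exact le_mul_of_forall_gt_le_mul (display_rhs_nonneg P l hη) h

/-- **Print's display is the conjunction of the dilated displays over `Λ > 1`** (`η ≥ 0`):
`Display P l η ↔ ∀ Λ > 1, DisplayWith P l η Λ` (§1 at `Λ₀ = 1` and the regression `displayWith_one_iff`).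
[claim: Mochizuki2012, status: disputed] -/
theorem display_iff_forall_gt_one_displayWith {P : NFPoint} {l : ℕ} {η : ℝ} (hη : 0 ≤ η) :
    Display P l η ↔ ∀ Λ : ℝ, 1 < Λ → DisplayWith P l η Λ := by
  rw [← displayWith_one_iff]
  exact displayWith_iff_forall_gt hη 1

/-- The dilation-currency form of §1 at `Λ₀ = 1`: if the DILATED display `(1/6)·(μ·log(q^{∤{2,l}})) ≤ [print's
RHS]` holds for EVERY `0 < μ < 1`, then print's display holds (`η ≥ 0`). [claim: Mochizuki2012, status: disputed] -/
theorem display_of_forall_mu_dilated {P : NFPoint} {l : ℕ} {η : ℝ} (hη : 0 ≤ η)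
    (h : ∀ μ : ℝ, 0 < μ → μ < 1 →
      1 / 6 * (μ * logQAvoid P {2, l}) ≤
        (1 + 20 * (dmod P : ℝ) / l) * (P.logDiff + logCondAvoid P {2, l})
          + 20 * (2 ^ 12 * 3 ^ 3 * 5 * (dmod P : ℝ) * l + η)) :
    Display P l η := by
  refine (display_iff_forall_gt_one_displayWith hη).2 fun Λ hΛ => ?_
  have hΛ0 : 0 < Λ := by linarith
  have key := displayWith_one_div_of_dilated (P := P) (l := l) (η := η) (μ := 1 / Λ) (by positivity)
    (h (1 / Λ) (by positivity) (by rw [div_lt_one hΛ0]; exact hΛ))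
  rwa [one_div_one_div] at key

/-- **The dilated Theorem-1.10 interface is RIGHT-CONTINUOUS in the coefficient** (any `Λ₀`):
`Thm110LegendreWith Λ₀ ↔ ∀ Λ > Λ₀, Thm110LegendreWith Λ` — its hypotheses (`η_prm`, `λ ∈ U_X`, `l ≥ 5` prime,
`F`-core, (P2), (P5), (P6)) do not involve `Λ`, and its conclusion is the pointwise dilated display (§1, with
`η > 0` from `IsEtaPrm`). [claim: Mochizuki2012, status: disputed] -/
theorem thm110LegendreWith_iff_forall_gt (Λ₀ : ℝ) :
    Thm110LegendreWith Λ₀ ↔ ∀ Λ : ℝ, Λ₀ < Λ → Thm110LegendreWith Λ := by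
  refine ⟨fun h Λ hΛ => h.mono hΛ.le, fun h => ?_⟩
  intro η hη P hP l hl h5 hc h2 h5' h6
  exact (displayWith_iff_forall_gt hη.1.le Λ₀).2 fun Λ hΛ => h Λ hΛ η hη P hP l hl h5 hc h2 h5' h6

/-- **The record interface is the conjunction of the dilated interfaces over `Λ > 1`**:
`Thm110Legendre ↔ ∀ Λ > 1, Thm110LegendreWith Λ` (§1 at `Λ₀ = 1` and `thm110LegendreWith_one_iff`). The
kernel form, on the [IUTchIV] side, of "drive the coefficient to `1⁺`": supplying the dilated interface at
EVERY `Λ > 1` is supplying the record interface itself. [claim: Mochizuki2012, status: disputed] -/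
theorem thm110Legendre_iff_forall_gt_one :
    Thm110Legendre ↔ ∀ Λ : ℝ, 1 < Λ → Thm110LegendreWith Λ := by
  rw [← thm110LegendreWith_one_iff]
  exact thm110LegendreWith_iff_forall_gt 1

/-- **The same in the dilation currency `μ₀ = 1/Λ` of the exponent programme**:
`Thm110Legendre ↔ ∀ μ₀ ∈ (0,1), Thm110LegendreWith (1/μ₀)` (`Λ = 1/μ₀` runs through all of `(1, ∞)`).
[claim: Mochizuki2012, status: disputed] -/
theorem thm110Legendre_iff_forall_mu :
    Thm110Legendre ↔ ∀ μ₀ : ℝ, 0 < μ₀ → μ₀ < 1 → Thm110LegendreWith (1 / μ₀) := by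
  rw [thm110Legendre_iff_forall_gt_one]
  refine ⟨fun h μ₀ h0 h1 => h _ ((one_lt_div h0).2 h1), fun h Λ hΛ => ?_⟩
  have hΛ0 : 0 < Λ := by linarith
  have key := h (1 / Λ) (by positivity) (by rw [div_lt_one hΛ0]; exact hΛ)
  rwa [one_div_one_div] at key

/-- Monotone reading of §1: the dilated interface at every `Λ > 1` gives it at every `Λ' ≥ 1` (including
`Λ' = 1`). [claim: Mochizuki2012, status: disputed] -/
theorem thm110LegendreWith_of_forall_gt_one (h : ∀ Λ : ℝ, 1 < Λ → Thm110LegendreWith Λ) {Λ' : ℝ}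
    (hΛ' : 1 ≤ Λ') : Thm110LegendreWith Λ' :=
  ((thm110LegendreWith_iff_forall_gt 1).2 h).mono hΛ'

/-! ## §2 The ends in the limit `Λ → 1⁺`: the record chain applies, no `GenEll_thm21_primesWith` binder -/

/-- **Cor. 2.2 from the dilated interface at every `Λ > 1`**: `∃ H_unif, Corollary22 H_unif` (the record
`exists_corollary22_of_thm110Legendre`, Galois-image input discharged by `fullGaloisImage_holds`, applied
to §1). [claim: Mochizuki2012, status: disputed] -/
theorem exists_corollary22_of_forall_gt_one_thm110LegendreWith
    (h : ∀ Λ : ℝ, 1 < Λ → Thm110LegendreWith Λ) : ∃ Hunif : ℝ, Corollary22 Hunif :=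
  exists_corollary22_of_thm110Legendre (thm110Legendre_iff_forall_gt_one.2 h) fullGaloisImage_holds

/-- **[GenEll] Thm. 2.1 (ii) at `Σ = {2}` from the dilated interface at every `Λ > 1`** — the record's
`ABCCompactlyBounded {2}` itself, not a `With`-variant (record `abcCompactlyBounded_two_of_thm110Legendre`
applied to §1). [claim: Mochizuki2012, status: disputed] -/
theorem abcCompactlyBounded_two_of_forall_gt_one_thm110LegendreWith
    (h : ∀ Λ : ℝ, 1 < Λ → Thm110LegendreWith Λ) : ABCCompactlyBounded ({2} : Finset ℕ) :=
  abcCompactlyBounded_two_of_thm110Legendre (thm110Legendre_iff_forall_gt_one.2 h)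

-- Cross-check (second kernel route, same statement): (ii)_Λ at every `Λ > 1` through the `With`-chain
-- (`abcCompactlyBoundedWith_two_of_thm110LegendreWith`), then the [GenEll]-side limit
-- `abcCompactlyBounded_iff_forall_gt_one`.
example (h : ∀ Λ : ℝ, 1 < Λ → Thm110LegendreWith Λ) : ABCCompactlyBounded ({2} : Finset ℕ) :=
  (abcCompactlyBounded_iff_forall_gt_one {2}).2 fun Λ hΛ =>
    abcCompactlyBoundedWith_two_of_thm110LegendreWith hΛ.le (h Λ hΛ)

/-- **[IUTchIV] Cor. 2.3 for `(ℙ¹_ℚ, {0,1,∞})` in every degree `d ≥ 1` from the dilated interface at every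
`Λ > 1`** — `VojtaP1Deg d` (coefficient `1 + ε`), with the [GenEll] transfer PROVED at `Λ = 1`
(`GenEll_thm21_primes_holds`); no `GenEll_thm21_primesWith` binder. [claim: Mochizuki2012, status: disputed] -/
theorem vojtaP1Deg_of_forall_gt_one_thm110LegendreWith (h : ∀ Λ : ℝ, 1 < Λ → Thm110LegendreWith Λ)
    {d : ℕ} (hd : 0 < d) : VojtaP1Deg d :=
  vojtaP1Deg_of_thm110Legendre (thm110Legendre_iff_forall_gt_one.2 h) GenEll_thm21_primes_holds hd

-- Cross-check through the [GenEll]-side limit file (`vojtaP1Deg_of_forall_gt_one_abcCompactlyBoundedWith`).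
example (h : ∀ Λ : ℝ, 1 < Λ → Thm110LegendreWith Λ) {d : ℕ} (hd : 0 < d) : VojtaP1Deg d :=
  vojtaP1Deg_of_forall_gt_one_abcCompactlyBoundedWith two_primes
    (fun Λ hΛ => abcCompactlyBoundedWith_two_of_thm110LegendreWith hΛ.le (h Λ hΛ)) hd

/-- **THE DILATED INTERFACE AT EVERY `Λ > 1` ⟹ abc** (the displayed sentence
`∀ ε > 0, ∃ C > 0, ∀ abc triples (a, b, c), c < C·rad(abc)^{1+ε}`): the record endpoint `abc_of_thm110Legendre`
applied to §1, its [GenEll] input given by the PROVED `GenEll_thm21_primes_holds`. ONE hypothesis, of the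
[IUTchIV] shape, at every `Λ > 1`; NO `GenEll_thm21_primesWith Λ` binder (contrast: at a FIXED `Λ > 1` the
all-triples end `abcExp_of_thm110LegendreWith` carries that open binder — R19). CONDITIONAL: nothing asserts
the hypothesis; no side is taken on Cor. 3.12. [claim: Mochizuki2012, status: disputed] -/
theorem abc_of_forall_gt_one_thm110LegendreWith (h : ∀ Λ : ℝ, 1 < Λ → Thm110LegendreWith Λ) :
    ∀ ε : ℝ, 0 < ε → ∃ C : ℝ, 0 < C ∧
      ∀ a b c : ℕ, IsABCTriple a b c → (c : ℝ) < C * ((rad a b c : ℕ) : ℝ) ^ (1 + ε) :=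
  abc_of_thm110Legendre (thm110Legendre_iff_forall_gt_one.2 h) GenEll_thm21_primes_holds

-- Cross-check through the `With`-chain and the [GenEll]-side limit (`abc_of_forall_gt_one_abcCompactlyBoundedWith`).
example (h : ∀ Λ : ℝ, 1 < Λ → Thm110LegendreWith Λ) :
    ∀ ε : ℝ, 0 < ε → ∃ C : ℝ, 0 < C ∧
      ∀ a b c : ℕ, IsABCTriple a b c → (c : ℝ) < C * ((rad a b c : ℕ) : ℝ) ^ (1 + ε) :=
  abc_of_forall_gt_one_abcCompactlyBoundedWith two_primes fun Λ hΛ =>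
    abcCompactlyBoundedWith_two_of_thm110LegendreWith hΛ.le (h Λ hΛ)

/-- The same with the conclusion in the `With`-vocabulary: `ABCWithExponent 1` (`abcWithExponent_one_iff`),
hence `ABCWithExponent Λ'` for every `Λ' ≥ 1` (`ABCWithExponent.of_le`). [claim: Mochizuki2012, status: disputed] -/
theorem abcWithExponent_of_forall_gt_one_thm110LegendreWith (h : ∀ Λ : ℝ, 1 < Λ → Thm110LegendreWith Λ)
    {Λ' : ℝ} (hΛ' : 1 ≤ Λ') : ABCWithExponent Λ' :=
  (abcWithExponent_one_iff.2 (abc_of_forall_gt_one_thm110LegendreWith h)).of_le hΛ'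

/-- **THE DILATION CURRENCY: `Thm110LegendreWith (1/μ₀)` AT EVERY `μ₀ ∈ (0,1)` ⟹ abc** (displayed sentence,
exponent `1 + ε`) — the [IUTchIV]-side door of the exponent programme in the limit `μ₀ → 1⁻`
(`thm110Legendre_iff_forall_mu` + the record endpoint; [GenEll] input `GenEll_thm21_primes_holds`). CONDITIONAL
on its one hypothesis; nothing asserts it. [claim: Mochizuki2012, status: disputed] -/
theorem abc_of_forall_mu_thm110LegendreWith
    (h : ∀ μ₀ : ℝ, 0 < μ₀ → μ₀ < 1 → Thm110LegendreWith (1 / μ₀)) :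
    ∀ ε : ℝ, 0 < ε → ∃ C : ℝ, 0 < C ∧
      ∀ a b c : ℕ, IsABCTriple a b c → (c : ℝ) < C * ((rad a b c : ℕ) : ℝ) ^ (1 + ε) :=
  abc_of_thm110Legendre (thm110Legendre_iff_forall_mu.2 h) GenEll_thm21_primes_holds

/-- The same with the conclusion `ABCWithExponent 1`. [claim: Mochizuki2012, status: disputed] -/
theorem abcWithExponent_one_of_forall_mu_thm110LegendreWith
    (h : ∀ μ₀ : ℝ, 0 < μ₀ → μ₀ < 1 → Thm110LegendreWith (1 / μ₀)) : ABCWithExponent 1 :=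
  abcWithExponent_one_iff.2 (abc_of_forall_mu_thm110LegendreWith h)

-- Cross-check through the `With`-chain in the dilation currency
-- (`abcCompactlyBoundedWith_two_of_thm110LegendreWith_one_div`) and the [GenEll]-side
-- `abcWithExponent_one_of_forall_mu_abcCompactlyBoundedWith`.
example (h : ∀ μ₀ : ℝ, 0 < μ₀ → μ₀ < 1 → Thm110LegendreWith (1 / μ₀)) : ABCWithExponent 1 :=
  abcWithExponent_one_of_forall_mu_abcCompactlyBoundedWith two_primes fun μ₀ h0 h1 =>
    abcCompactlyBoundedWith_two_of_thm110LegendreWith_one_div h0 h1.le (h μ₀ h0 h1)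

end Cor22

end Literature.IUT.LogVolume

end
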